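import Summits.BirchSwinnertonDyer.Rank1Residual.Additive.CongruentPartnerMainConjectureGord
import Summits.BirchSwinnertonDyer.Rank1Residual.AdditivePotMult.PotMultBudgetRankZeroEnds
import HarnessLib

/-!
# "ROUTE G" on X3♯(G-ord) ∩ `I₀*` (REDUCIBLE `E[p]`), every odd `p`: the tame-branch MAIN CONJECTURE
# at `E` from Wuthrich's divisibility (Doc. Math. 19 (2014) Thm. 16) + ONE unit coefficient at index
# `b` + the typed budget bound `BudgetLeLambdaAt p W b`, and its Λ-adic LOWER output
# `ChiBranchLowerDivisibility[Odd]At W p` / `QuadraticBranchLowerDivisibilityAt V p` — the X3♯(G-ord)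
# twin of n1011-p10's `CongruentPartnerMainConjectureGord.lean` (team n1011, seat n1011-p06 gen 3,
# OWNERS row T-E3gX3 = lead GEN 6 R5-31 deal (β); FILE 1 of 3)

HONEST FRAMING (cell `b2b-bsdres`, run/shared/lean/b2b/bsd-rank1-residual/, verbatim in every
file): the goal of the cell is to DELETE the COMBINATION-SHAPED residual classes of the
Birch–Swinnerton-Dyer formula for ALL analytic-rank `≤ 1` elliptic curves over `ℚ` — "full BSD
formula for every rank `≤ 1` curve in class `C`" assembled STRICTLY from published theorems — so
that the rank-`≤ 1` remainder becomes exactly the CONSTRUCTION-SHAPED classes, which are TYPED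
(missing-input `Prop`s), NOT attempted. This is not "finishing BSD". Team n1011 (RESIDUAL-MAP §I
N10 / O7-ord, the X3♯(G-ord) share: `E[p]` REDUCIBLE, additive potentially good ordinary of type (G)
at `p`, defect `e = 2`): research route on a CONSTRUCTION-SHAPED class; prove what is provable now; no
claim beyond stated classes; census output = EVIDENCE / conjecture items, never a Literature fact;
X3♯(G-ord) stays CONSTRUCTION-SHAPED; RESIDUAL-MAP marks UNCHANGED; nothing is booked by this file.
THEOREMS ONLY (no definition, no named fact, no conjecture node); the named fact enters as a
HYPOTHESIS: `hWu` = Wuthrich 2014 Thm. 16 in its half-eigenspace form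
(`Wuthrich2014.thm16_halfEigenCharIdeal_dvd_cyclotomicPrime`, via lit-kato's `…_of_half` bridge);
p10's typed inputs `BranchUnitCoeffAt W p b` (index-`b` certificate shape; per pair an ENGINE value,
two-engine rule) and `BudgetLeLambdaAt p W b` (per-curve lower bound on `λ`) are HYPOTHESES, consumed BY
NAME, NOT re-declared.

## What and why (ROUTE-2 II.10 K-E / K-OUT on the reducible rows)

p10's image-free core (`CongruentPartnerMainConjecture.lean`: `hasUnitContent_and_lam_le_of_iota_eq_…`,
`exists_charIdeal_eq_span`, `mu_zero_of_charIdeal_eq_span_of_dvd`,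
`span_eq_and_mu_zero_and_lambda_eq_of_dvd_of_lam_le_of_le`, `forall_mem_charIdeal_exists_iota_eq_mul`)
needs from the arithmetic exactly ONE thing: `X(E/ℚ_∞)` torsion and an INTEGRAL `g ∈ char_Λ X` with
`ι g = C(u·ϖ)·B_{(p−1)/2}`. On X4♯(G-ord) ∩ {`ρ̄` onto} that is Kato 17.4 (3) + the `p`-adic tower of the
twist (p10's wrappers). On X3♯(G-ord) — `E[p]` REDUCIBLE, so `E♭[p]` reducible too — it is additive-p2
gen 19's reducible full-series brick `isTorsion_and_exists_iota_eq_branch_of_wuthrichComponent` fed by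
Wuthrich 2014 Thm. 16 (`hWu`): NO image hypothesis, NO tower, every odd `p` (3 included). Hence:

* §1 `ClassX3Gord.mainConjecture_of_wuthrichHalf_of_coeff_of_le` (per datum and per twist datum):
  Wuthrich half + the unit coefficient at index `b` + `b ≤ λ(X(E/ℚ_∞))` ⟹ `char_Λ X = (g)` with
  `ι g = C(u·ϖ)·B`, `μ = 0`, `λ = b`; class form `…_of_coeffCert_of_budget` (K-F₀ budget).
* §2 K-OUT: `ClassX3Gord.chiBranchLowerDivisibilityAt_of_wuthrichHalf_of_coeffCert_of_budget`
  (`p ≡ 1 (mod 4)`), `…OddAt…` (`p ≡ 3 (mod 4)`, `p = 3` included) — p07's typed W-level Λ-adic LOWER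
  inputs — and p10's twist-model node `QuadraticBranchLowerDivisibilityAt V p` for EVERY model `V` of
  `E^{(p*)}` (p07 g2's class-free `TypeGOrd.forall_quadraticBranchLower_iff_…`). So on a certified
  eligible X3♯(G-ord) row the LOWER conjecture node is a THEOREM and the existing `T = 0` consumers
  (`ClassX3Gord.missingLowerBoundAt_rankZero_of_cycLower_of_nonAnomalous`, …) apply by name (FILE 2).
* §3 MINIMAL rows (`b ≤ rank E(ℚ)`): the budget is DISCHARGED by p07-g3's reduction- and image-agnostic
  `AdditivePotMult.budgetLeLambdaAt_of_le_mordellWeilRank`, so `…_of_coeffCert_of_le_rank`: Wuthrich half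
  + ONE unit coefficient at an index `b ≤ rank E(ℚ)` ⟹ the main conjecture on the branch and p10's LOWER
  node for every twist model — NO typed input at all (the X3♯(G-ord) analogue of n1011-p12's X3♯(M)
  `…_firstUnitIndex_of_le_rank`; `b = 0` = the unit rows, `b = 1` = the rank-one certificate rows).
* §4 `ClassX3Gord.isTorsion_and_mu_zero_of_wuthrichHalf_of_coeff[Cert]`: ONE unit coefficient at ANY
  index ⟹ `X(E/ℚ_∞)` torsion and `μ = 0` — NO budget, NO lower bound (twin of p10's
  `ClassX4Gord.isTorsion_and_mu_zero_of_katoHalf_of_coeff[Cert]`, `…GordEPW.lean` §1). Worth stating on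
  X3: for REDUCIBLE `E[p]` the vanishing of `μ` is NOT automatic (Greenberg's `μ > 0` examples are
  reducible rows), so here one finite `p`-adic computation CERTIFIES `μ(X(E/ℚ_∞)) = 0` per pair.

What is NOT transcribed here, and why (binder honesty): the CONGRUENT-PARTNER form K-C′ of p10's
file (`TorsionIso` / `CongruentLambdaShift W W₁ p e`) — its X4 per-pair reading, Emerton–Pollack–Weston
2006 Thm. 3.3.3 on the Hida family of `ρ̄_{E♭}`, is printed for `ρ̄` absolutely IRREDUCIBLE and
`p`-distinguished; a reducible-row reading would be Greenberg–Vatsal-2000-shaped (schema as a per-pair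
HYPOTHESIS, as n1011-p12 records it on X3♯(M)) and is left to a sequel on demand. Likewise the intended
per-curve discharge of `BudgetLeLambdaAt` (EPW Cor. 3.2.5 + Thm. 3.1.1) is printed under `ρ̄`
irreducible; on X3 rows its intended reading is route planner 2's ROUTE-2 II.13.2: Greenberg 1999
Prop. 4.14 (no proper finite-index Λ-submodule) + Greenberg 2010 Prop. 3.2.1 (b) (residual surjection)
+ the local dictionary II.10.9, TO BE INSTANTIATED — the lead's commission T-E3gX3-bud (R5-32); until it
reports, on X3 rows the budget input stays TYPED, with the only
reduction- and image-agnostic discharges in the tree being `b ≤ rank E(ℚ)` (p07-g3's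
`AdditivePotMult.budgetLeLambdaAt_of_le_mordellWeilRank`) and `b = 0` (flag `X3-budget-no-EPW` ≡ r2's `X3-budget-unprinted`, ROUTE-2 §II.13–14). The unit
coefficient is an ENGINE value (two-engine rule), EVIDENCE until certified; nothing booked; no class
theorem closes a row by itself; e ∈ {3,4,6}, wild 3, `p = 2` untouched.

References: C. Wuthrich, Doc. Math. 19 (2014) Thm. 16 (p. 397) [Wuthrich2014]; R. Greenberg, LNM 1716
(1999) §5 [GreenbergLNM1716]; M. Emerton, R. Pollack, T. Weston, Invent. Math. 163 (2006) §3
[EmertonPollackWeston2006] (shape; printed for ρ̄ irreducible); R. Greenberg, V. Vatsal, Invent. Math.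
142 (2000) §2 [GreenbergVatsal2000] (shape of a reducible-row partner reading; not used); C. Skinner, E. Urban, Invent. Math. 195
(2014) Thm. 3.6.4 (shape of the LOWER node) [SkinnerUrban2014]; B. Mazur, J. Tate, J. Teitelbaum,
Invent. Math. 84 (1986) §I.13 [MazurTateTeitelbaum1986Invent]; L. Washington, GTM 83 §13.2 [Washington1997].
-/

set_option autoImplicit false

noncomputable section

open scoped Classical MatrixGroups ModularForm NumberField

open CongruenceSubgroup WeierstrassCurve NumberField Literature.NumberTheory.EllipticCurves
  Literature.NumberTheory.EllipticCurves.ModularForms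
  Literature.NumberTheory.EllipticCurves.Rank1Residual
  Literature.NumberTheory.EllipticCurves.Rank1Residual.Typed
  Literature.NumberTheory.GaloisRepresentations
  Literature.NumberTheory.EllipticCurves.Wuthrich2014
  Literature.NumberTheory.EllipticCurves.GreenbergVatsal2000
  Summit.BirchSwinnertonDyer.Rank1Residual.AdditivePotMult
  Summit.BirchSwinnertonDyer.Rank1Residual.X1.MuLambda
  Summit.BirchSwinnertonDyer.Rank1Residual.X11a
  Summit.BirchSwinnertonDyer.Rank1Residual.Iwasawa
  IsDedekindDomain

namespace Summit.BirchSwinnertonDyer.Rank1Residual.Additive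

variable {W : WeierstrassCurve ℚ} [W.IsElliptic] [W.IsGloballyMinimal] {p : ℕ} [hp : Fact p.Prime]

/-! ### §1 The main conjecture on the branch, per datum (reducible rows, Wuthrich Thm. 16) -/

omit [W.IsGloballyMinimal] in
/-- **K-E, per datum (X3♯(G-ord) ∩ `I₀*`, every odd `p`, NO image hypothesis, NO tower).** For `W` in
X3♯(G-ord) (`E[p]` reducible, type (G)-ordinary at `p`), a globally minimal good-ordinary `V` with
`C • V^{(p*)} = W`, the cyclotomic data, the newform `f` of `V`, the period ratio `ϖ` of the parity of
`(p−1)/2`, and a finitely generated dual datum `D` of `Sel_{p^∞}(E/ℚ_∞)`: IF the Néron-normalised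
branch has a unit coefficient at index `b` AND `b ≤ λ(D.X)`, THEN `X` is torsion and the main
conjecture holds on the branch — `char_Λ X = (g)` for the Wuthrich–Kato element `g`,
`ι g = C(u·ϖ)·B_{(p−1)/2}`, `u ∈ ℤ_pˣ` — with `μ(X) = 0` and `λ(X) = b`. Inputs: the half-eigenspace
reading of Wuthrich 2014 Thm. 16 (`hWu`, via `…_of_half`), additive-p2's reducible brick, p10's squeeze.
[cite: Wuthrich2014, Thm. 16 (p. 397)] [cite: Washington1997, §13.2] -/
theorem ClassX3Gord.mainConjecture_of_wuthrichHalf_of_coeff_of_le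
    (hWu : Wuthrich2014.thm16_halfEigenCharIdeal_dvd_cyclotomicPrime)
    (hp2 : p ≠ 2) (hX : ClassX3Gord W p)
    (V : WeierstrassCurve ℚ) [V.IsElliptic] [V.IsGloballyMinimal]
    (hCW : ∃ C : VariableChange ℚ, C • V.quadraticTwist ((-1 : ℚ) ^ (p / 2) * p) = W)
    (hV : GoodOrd V p)
    {κ : ZpExtension ℚ p} {γ : Field.absoluteGaloisGroup ℚ} {N : ℕ} [NeZero N]
    {f : CuspForm (Gamma0 N) 2}
    (hκ : κ.IsCyclotomic) (hγ : κ.IsTopGenerator γ) (hcv : IsCyclotomicVariable p γ)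
    (hf : IsNewformOf V f) (D : W.SelmerDualData κ γ) [Module.Finite (IwasawaAlgebra p) D.X] (ϖ : ℚ)
    (hϖ : if Even (p / 2) then (ϖ : ℝ) * V.realPeriodRat = plusPeriod f
      else (ϖ : ℝ) * V.imaginaryPeriodRat = minusPeriod f)
    {b : ℕ}
    (hcoeff : ‖PowerSeries.coeff b (PowerSeries.C (ϖ : ℚ_[p]) *
        (if Even (p / 2) then padicLFunctionBranch f ((unitRoot V p : ℤ_[p]) : ℚ_[p]) (p / 2)
          else padicLFunctionMinusBranch f ((unitRoot V p : ℤ_[p]) : ℚ_[p]) (p / 2)))‖ = 1)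
    (hge : D.IsTorsion → D.mu = 0 → b ≤ lambdaInvariant p D.X) :
    D.IsTorsion ∧ ∃ (g : IwasawaAlgebra p) (u : ℤ_[p]ˣ), D.charIdeal = Ideal.span {g} ∧
      iwasawaToPowerSeries p g =
        PowerSeries.C (((u : ℤ_[p]) : ℚ_[p]) * (ϖ : ℚ_[p])) *
          (if Even (p / 2) then padicLFunctionBranch f ((unitRoot V p : ℤ_[p]) : ℚ_[p]) (p / 2)
            else padicLFunctionMinusBranch f ((unitRoot V p : ℤ_[p]) : ℚ_[p]) (p / 2)) ∧
      D.mu = 0 ∧ lambdaInvariant p D.X = b := by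
  have hj := padicValRat_j_nonneg_of_typeGOrd W p hX.typeGOrd
  obtain ⟨hXt, g, hg, u, hι⟩ := isTorsion_and_exists_iota_eq_branch_of_wuthrichComponent W p
    (Wuthrich2014.charIdeal_dvd_padicLFunctionBranch_component_of_half hWu) hj hp2 V hCW (Or.inl hV)
    hX.classX3.1 hκ hγ hcv hf D ϖ hϖ
  obtain ⟨hgc, hlam⟩ := hasUnitContent_and_lam_le_of_iota_eq_of_norm_coeff_eq_one hι hcoeff
  obtain ⟨fE, hchar⟩ := exists_charIdeal_eq_span D hXt
  have hdvd : fE ∣ g := by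
    rw [hchar] at hg
    exact Ideal.mem_span_singleton.mp hg
  have hmu : D.mu = 0 := mu_zero_of_charIdeal_eq_span_of_dvd D hXt hchar hgc hdvd
  obtain ⟨hspan, -, hlamD⟩ := span_eq_and_mu_zero_and_lambda_eq_of_dvd_of_lam_le_of_le D hXt hchar
    hgc hdvd hlam (hge hXt hmu)
  exact ⟨hXt, g, u, hchar.trans hspan.symm, hι, hmu, hlamD⟩

/-- **K-E with the BUDGET (class form; NO partner, NO image hypothesis).** X3♯(G-ord) ∩ `I₀*`, every
odd `p`: Wuthrich half + `BranchUnitCoeffAt W p b` + `BudgetLeLambdaAt p W b` ⟹ for the cyclotomic data,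
EVERY good-ordinary twist model / newform / period ratio and every dual datum: `X` torsion,
`char_Λ X = (g)` with `ι g = C(u·ϖ)·B`, `μ = 0`, `λ = b`. (On X3 the budget's EPW discharge is NOT
printed — flag `X3-budget-no-EPW`, lead commission T-E3gX3-bud; `b ≤ rank E(ℚ)` / `b = 0` are the tree's
image-free sources.)
[cite: Wuthrich2014, Thm. 16 (p. 397)]
[cite: EmertonPollackWeston2006, Cor. 3.2.5 and Thm. 3.1.1 (shape of the budget input only; printed for ρ̄ irreducible)] -/
theorem ClassX3Gord.mainConjecture_of_wuthrichHalf_of_coeffCert_of_budget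
    (hWu : Wuthrich2014.thm16_halfEigenCharIdeal_dvd_cyclotomicPrime)
    (hp2 : p ≠ 2) (hX : ClassX3Gord W p) {b : ℕ} (hcert : BranchUnitCoeffAt W p b) (hbud : BudgetLeLambdaAt p W b)
    (V : WeierstrassCurve ℚ) [V.IsElliptic] [V.IsGloballyMinimal] (C : VariableChange ℚ)
    (hC : C • V.quadraticTwist ((-1 : ℚ) ^ (p / 2) * p) = W) (hV : GoodOrd V p)
    {κ : ZpExtension ℚ p} {γ : Field.absoluteGaloisGroup ℚ} {N : ℕ} [NeZero N]
    {f : CuspForm (Gamma0 N) 2}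
    (hκ : κ.IsCyclotomic) (hγ : κ.IsTopGenerator γ) (hcv : IsCyclotomicVariable p γ)
    (hf : IsNewformOf V f) (D : W.SelmerDualData κ γ) (ϖ : ℚ)
    (hϖ : if Even (p / 2) then (ϖ : ℝ) * V.realPeriodRat = plusPeriod f
      else (ϖ : ℝ) * V.imaginaryPeriodRat = minusPeriod f) :
    D.IsTorsion ∧ ∃ (g : IwasawaAlgebra p) (u : ℤ_[p]ˣ), D.charIdeal = Ideal.span {g} ∧
      iwasawaToPowerSeries p g =
        PowerSeries.C (((u : ℤ_[p]) : ℚ_[p]) * (ϖ : ℚ_[p])) *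
          (if Even (p / 2) then padicLFunctionBranch f ((unitRoot V p : ℤ_[p]) : ℚ_[p]) (p / 2)
            else padicLFunctionMinusBranch f ((unitRoot V p : ℤ_[p]) : ℚ_[p]) (p / 2)) ∧
      D.mu = 0 ∧ lambdaInvariant p D.X = b := by
  haveI : Module.Finite (IwasawaAlgebra p) D.X :=
    SelmerDualData.module_finite_of_isCyclotomic (W := W) (κ := κ) hκ D hγ
  have hord : IsOrdinaryAt V p := isOrdinaryAt_of_goodOrd_or_mult_of_model_twist W V (pStar_ne_zero p)
    ⟨C, hC⟩ (padicValRat_j_nonneg_of_typeGOrd W p hX.typeGOrd) (Or.inl hV)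
  exact hX.mainConjecture_of_wuthrichHalf_of_coeff_of_le hWu hp2 V ⟨C, hC⟩ hV hκ hγ hcv hf D ϖ hϖ
    (hcert V C hC hord f hf ϖ hϖ) (fun hXt hmu ↦ hbud hκ hγ hcv D hXt hmu)

/-! ### §2 K-OUT: the Λ-adic LOWER inputs of team n1011 follow (both parities; reducible rows) -/

/-- **K-OUT, `p ≡ 1 (mod 4)`: `ChiBranchLowerDivisibilityAt W p`** (p07's W-level Λ-adic LOWER input)
on X3♯(G-ord) ∩ `I₀*`, GIVEN Wuthrich half + `BranchUnitCoeffAt W p b` + `BudgetLeLambdaAt p W b`.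
NO image hypothesis. [cite: Wuthrich2014, Thm. 16 (p. 397)]
[cite: SkinnerUrban2014, Thm. 3.6.4 (p. 43) (shape of the node; nothing of SU is used)] -/
theorem ClassX3Gord.chiBranchLowerDivisibilityAt_of_wuthrichHalf_of_coeffCert_of_budget
    (hWu : Wuthrich2014.thm16_halfEigenCharIdeal_dvd_cyclotomicPrime)
    (hX : ClassX3Gord W p) {b : ℕ} (hcert : BranchUnitCoeffAt W p b) (hbud : BudgetLeLambdaAt p W b) :
    ChiBranchLowerDivisibilityAt W p := by
  intro V _ _ κ γ N _ f hp1 hCW hV hκ hγ hcv hf D ϖ hϖ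
  have hp2 : p ≠ 2 := by omega
  have heven : Even (p / 2) := ⟨p / 4, by omega⟩
  obtain ⟨C, hC⟩ := hCW
  have hC' : C • V.quadraticTwist ((-1 : ℚ) ^ (p / 2) * p) = W := by
    rw [pStar_eq_of_mod_four p (Or.inl hp1), if_pos hp1]; exact hC
  have hϖ' : (if Even (p / 2) then (ϖ : ℝ) * V.realPeriodRat = plusPeriod f
      else (ϖ : ℝ) * V.imaginaryPeriodRat = minusPeriod f) := by rw [if_pos heven]; exact hϖ
  obtain ⟨-, g, u, hchar, hι, -, -⟩ := hX.mainConjecture_of_wuthrichHalf_of_coeffCert_of_budget hWu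
    hp2 hcert hbud V C hC' hV hκ hγ hcv hf D ϖ hϖ'
  rw [if_pos heven] at hι
  exact forall_mem_charIdeal_exists_iota_eq_mul D hchar hι

/-- **K-OUT, `p ≡ 3 (mod 4)` (`p = 3` included): `ChiBranchLowerDivisibilityOddAt W p`** on
X3♯(G-ord) ∩ `I₀*`, GIVEN Wuthrich half + `BranchUnitCoeffAt W p b` + `BudgetLeLambdaAt p W b`. NO image
hypothesis, NO tower. [cite: Wuthrich2014, Thm. 16 (p. 397)]
[cite: SkinnerUrban2014, Thm. 3.6.4 (p. 43) (shape of the node; nothing of SU is used)] -/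
theorem ClassX3Gord.chiBranchLowerDivisibilityOddAt_of_wuthrichHalf_of_coeffCert_of_budget
    (hWu : Wuthrich2014.thm16_halfEigenCharIdeal_dvd_cyclotomicPrime)
    (hX : ClassX3Gord W p) {b : ℕ} (hcert : BranchUnitCoeffAt W p b) (hbud : BudgetLeLambdaAt p W b) :
    ChiBranchLowerDivisibilityOddAt W p := by
  intro V _ _ κ γ N _ f hp3 hCW hV hκ hγ hcv hf D ϖ hϖ
  have hp2 : p ≠ 2 := by omega
  have hodd : ¬ Even (p / 2) := by rw [Nat.not_even_iff_odd]; exact ⟨p / 4, by omega⟩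
  obtain ⟨C, hC⟩ := hCW
  have hC' : C • V.quadraticTwist ((-1 : ℚ) ^ (p / 2) * p) = W := by
    rw [pStar_eq_of_mod_four p (Or.inr hp3), if_neg (by omega)]; exact hC
  have hϖ' : (if Even (p / 2) then (ϖ : ℝ) * V.realPeriodRat = plusPeriod f
      else (ϖ : ℝ) * V.imaginaryPeriodRat = minusPeriod f) := by rw [if_neg hodd]; exact hϖ
  obtain ⟨-, g, u, hchar, hι, -, -⟩ := hX.mainConjecture_of_wuthrichHalf_of_coeffCert_of_budget hWu
    hp2 hcert hbud V C hC' hV hκ hγ hcv hf D ϖ hϖ'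
  rw [if_neg hodd] at hι
  exact forall_mem_charIdeal_exists_iota_eq_mul D hchar hι

/-- **K-OUT, twist-model form: p10's conjecture node `QuadraticBranchLowerDivisibilityAt V p` is a
THEOREM for EVERY model `V` of `E^{(p*)}`** on a certified eligible X3♯(G-ord) row (Wuthrich half +
index-`b` certificate + budget; p07 g2's class-free ascent/descent
`TypeGOrd.forall_quadraticBranchLower_iff_chiBranchLowerDivisibility_and_odd`). NO image hypothesis.
[cite: Wuthrich2014, Thm. 16 (p. 397)] [cite: GreenbergLNM1716, §5 (PDF p. 143)] -/
theorem ClassX3Gord.quadraticBranchLowerDivisibilityAt_of_wuthrichHalf_of_coeffCert_of_budget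
    (hWu : Wuthrich2014.thm16_halfEigenCharIdeal_dvd_cyclotomicPrime)
    (hp2 : p ≠ 2) (hX : ClassX3Gord W p) {b : ℕ} (hcert : BranchUnitCoeffAt W p b) (hbud : BudgetLeLambdaAt p W b)
    (V : WeierstrassCurve ℚ) [V.IsElliptic] [V.IsGloballyMinimal]
    (hCW : ∃ C : VariableChange ℚ, C • V.quadraticTwist ((-1) ^ (p / 2) * p : ℚ) = W) :
    QuadraticBranchLowerDivisibilityAt V p :=
  (TypeGOrd.forall_quadraticBranchLower_iff_chiBranchLowerDivisibility_and_odd W p hp2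
      hX.typeGOrd).mpr
    ⟨hX.chiBranchLowerDivisibilityAt_of_wuthrichHalf_of_coeffCert_of_budget hWu hcert hbud,
      hX.chiBranchLowerDivisibilityOddAt_of_wuthrichHalf_of_coeffCert_of_budget hWu hcert hbud⟩
    V hCW

/-! ### §3 MINIMAL rows: unit coefficient at an index `b ≤ rank E(ℚ)` — NO budget input -/

/-- **MINIMAL rows, K-E without ANY typed input.** X3♯(G-ord) ∩ `I₀*`, every odd `p`: Wuthrich half +
`BranchUnitCoeffAt W p b` at an index `b ≤ rank E(ℚ)` ⟹ for the cyclotomic data, every good-ordinary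
twist model / newform / period ratio and every dual datum: `X` torsion, `char_Λ X = (g)` with
`ι g = C(u·ϖ)·B`, `μ = 0`, `λ = b` (the budget `BudgetLeLambdaAt p W b` is p07-g3's THEOREM
`AdditivePotMult.budgetLeLambdaAt_of_le_mordellWeilRank` for `b ≤ rank`). [cite: Wuthrich2014, Thm. 16 (p. 397)]
[cite: GreenbergLNM1716, §3 Lemma 3.1 (T^{rank} ∣ char)] -/
theorem ClassX3Gord.mainConjecture_of_wuthrichHalf_of_coeffCert_of_le_rank
    (hWu : Wuthrich2014.thm16_halfEigenCharIdeal_dvd_cyclotomicPrime)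
    (hp2 : p ≠ 2) (hX : ClassX3Gord W p) {b : ℕ} (hcert : BranchUnitCoeffAt W p b)
    (hb : b ≤ W.mordellWeilRank)
    (V : WeierstrassCurve ℚ) [V.IsElliptic] [V.IsGloballyMinimal] (C : VariableChange ℚ)
    (hC : C • V.quadraticTwist ((-1 : ℚ) ^ (p / 2) * p) = W) (hV : GoodOrd V p)
    {κ : ZpExtension ℚ p} {γ : Field.absoluteGaloisGroup ℚ} {N : ℕ} [NeZero N]
    {f : CuspForm (Gamma0 N) 2}
    (hκ : κ.IsCyclotomic) (hγ : κ.IsTopGenerator γ) (hcv : IsCyclotomicVariable p γ)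
    (hf : IsNewformOf V f) (D : W.SelmerDualData κ γ) (ϖ : ℚ)
    (hϖ : if Even (p / 2) then (ϖ : ℝ) * V.realPeriodRat = plusPeriod f
      else (ϖ : ℝ) * V.imaginaryPeriodRat = minusPeriod f) :
    D.IsTorsion ∧ ∃ (g : IwasawaAlgebra p) (u : ℤ_[p]ˣ), D.charIdeal = Ideal.span {g} ∧
      iwasawaToPowerSeries p g =
        PowerSeries.C (((u : ℤ_[p]) : ℚ_[p]) * (ϖ : ℚ_[p])) *
          (if Even (p / 2) then padicLFunctionBranch f ((unitRoot V p : ℤ_[p]) : ℚ_[p]) (p / 2)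
            else padicLFunctionMinusBranch f ((unitRoot V p : ℤ_[p]) : ℚ_[p]) (p / 2)) ∧
      D.mu = 0 ∧ lambdaInvariant p D.X = b :=
  hX.mainConjecture_of_wuthrichHalf_of_coeffCert_of_budget hWu hp2 hcert
    (AdditivePotMult.budgetLeLambdaAt_of_le_mordellWeilRank hb) V C hC hV hκ hγ hcv hf D ϖ hϖ

/-- **MINIMAL rows, K-OUT without ANY typed input**: X3♯(G-ord) ∩ `I₀*`, every odd `p`, Wuthrich half +
ONE unit coefficient at an index `b ≤ rank E(ℚ)` ⟹ p10's node `QuadraticBranchLowerDivisibilityAt V p`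
for EVERY model `V` of `E^{(p*)}` (`b = 0`: the unit rows; `b = 1`: the rank-one certificate rows —
there the typed LOWER `hdiv`/`hc` of p01's X3 IMC-version iffs is a THEOREM).
[cite: Wuthrich2014, Thm. 16 (p. 397)] [cite: GreenbergLNM1716, §3 Lemma 3.1 and §5 (PDF p. 143)] -/
theorem ClassX3Gord.quadraticBranchLowerDivisibilityAt_of_wuthrichHalf_of_coeffCert_of_le_rank
    (hWu : Wuthrich2014.thm16_halfEigenCharIdeal_dvd_cyclotomicPrime)
    (hp2 : p ≠ 2) (hX : ClassX3Gord W p) {b : ℕ} (hcert : BranchUnitCoeffAt W p b)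
    (hb : b ≤ W.mordellWeilRank)
    (V : WeierstrassCurve ℚ) [V.IsElliptic] [V.IsGloballyMinimal]
    (hCW : ∃ C : VariableChange ℚ, C • V.quadraticTwist ((-1) ^ (p / 2) * p : ℚ) = W) :
    QuadraticBranchLowerDivisibilityAt V p :=
  hX.quadraticBranchLowerDivisibilityAt_of_wuthrichHalf_of_coeffCert_of_budget hWu hp2 hcert
    (AdditivePotMult.budgetLeLambdaAt_of_le_mordellWeilRank hb) V hCW

/-! ### §4 ONE unit coefficient at ANY index ⟹ `X` torsion and `μ = 0` (reducible rows; NO budget) -/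

omit [W.IsGloballyMinimal] in
/-- **`X` torsion and `μ(X(E/ℚ_∞)) = 0`, per datum, on X3♯(G-ord)** (`E[p]` REDUCIBLE, every odd `p`, NO
image hypothesis): a globally minimal good-ordinary `V` with `C • V^{(p*)} = W`, the cyclotomic data, a
newform `f` of `V`, a period ratio `ϖ` of the parity of `(p−1)/2`, a finitely generated dual datum `D`:
ONE `p`-adic unit coefficient of `ϖ·B_{(p−1)/2}(f, α)` at ANY index `n` gives `X` torsion and `μ(X) = 0`
— Wuthrich's half puts an integral `g` with `ι g = C(u·ϖ)·B` in `char X = (fE)`, the unit coefficient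
gives `g` unit content, hence `fE ∣ g` has unit content. On reducible rows `μ = 0` is NOT automatic
(Greenberg's `μ > 0` examples), so this is a per-pair CERTIFICATE of `μ = 0`. [cite: Wuthrich2014, Thm. 16 (p. 397)]
[cite: Washington1997, §13.2] [cite: GreenbergLNM1716, §5 (μ can be positive when E[p] is reducible)] -/
theorem ClassX3Gord.isTorsion_and_mu_zero_of_wuthrichHalf_of_coeff
    (hWu : Wuthrich2014.thm16_halfEigenCharIdeal_dvd_cyclotomicPrime)
    (hp2 : p ≠ 2) (hX : ClassX3Gord W p)
    (V : WeierstrassCurve ℚ) [V.IsElliptic] [V.IsGloballyMinimal]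
    (hCW : ∃ C : VariableChange ℚ, C • V.quadraticTwist ((-1 : ℚ) ^ (p / 2) * p) = W)
    (hV : GoodOrd V p)
    {κ : ZpExtension ℚ p} {γ : Field.absoluteGaloisGroup ℚ} {N : ℕ} [NeZero N]
    {f : CuspForm (Gamma0 N) 2}
    (hκ : κ.IsCyclotomic) (hγ : κ.IsTopGenerator γ) (hcv : IsCyclotomicVariable p γ)
    (hf : IsNewformOf V f) (D : W.SelmerDualData κ γ) [Module.Finite (IwasawaAlgebra p) D.X] (ϖ : ℚ)
    (hϖ : if Even (p / 2) then (ϖ : ℝ) * V.realPeriodRat = plusPeriod f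
      else (ϖ : ℝ) * V.imaginaryPeriodRat = minusPeriod f)
    {n : ℕ}
    (hcoeff : ‖PowerSeries.coeff n (PowerSeries.C (ϖ : ℚ_[p]) *
        (if Even (p / 2) then padicLFunctionBranch f ((unitRoot V p : ℤ_[p]) : ℚ_[p]) (p / 2)
          else padicLFunctionMinusBranch f ((unitRoot V p : ℤ_[p]) : ℚ_[p]) (p / 2)))‖ = 1) :
    D.IsTorsion ∧ D.mu = 0 := by
  have hj := padicValRat_j_nonneg_of_typeGOrd W p hX.typeGOrd
  obtain ⟨hXt, g, hg, u, hι⟩ := isTorsion_and_exists_iota_eq_branch_of_wuthrichComponent W p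
    (Wuthrich2014.charIdeal_dvd_padicLFunctionBranch_component_of_half hWu) hj hp2 V hCW (Or.inl hV)
    hX.classX3.1 hκ hγ hcv hf D ϖ hϖ
  obtain ⟨hgc, -⟩ := hasUnitContent_and_lam_le_of_iota_eq_of_norm_coeff_eq_one hι hcoeff
  obtain ⟨fE, hchar⟩ := exists_charIdeal_eq_span D hXt
  have hdvd : fE ∣ g := by
    rw [hchar] at hg
    exact Ideal.mem_span_singleton.mp hg
  exact ⟨hXt, mu_zero_of_charIdeal_eq_span_of_dvd D hXt hchar hgc hdvd⟩

omit [W.IsGloballyMinimal] in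
/-- **`X` torsion and `μ(X(E/ℚ_∞)) = 0` on a certified X3♯(G-ord) ∩ `I₀*` row (class form)**, every odd
`p`, NO image hypothesis, NO budget: Wuthrich half + `BranchUnitCoeffAt W p b` (ANY `b`) ⟹ for the
cyclotomic data and every good-ordinary twist model / newform / period ratio / dual datum: `X` torsion
and `μ(X) = 0`. [cite: Wuthrich2014, Thm. 16 (p. 397)] [cite: Washington1997, §13.2] -/
theorem ClassX3Gord.isTorsion_and_mu_zero_of_wuthrichHalf_of_coeffCert
    (hWu : Wuthrich2014.thm16_halfEigenCharIdeal_dvd_cyclotomicPrime)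
    (hp2 : p ≠ 2) (hX : ClassX3Gord W p) {b : ℕ} (hcert : BranchUnitCoeffAt W p b)
    (V : WeierstrassCurve ℚ) [V.IsElliptic] [V.IsGloballyMinimal] (C : VariableChange ℚ)
    (hC : C • V.quadraticTwist ((-1 : ℚ) ^ (p / 2) * p) = W) (hV : GoodOrd V p)
    {κ : ZpExtension ℚ p} {γ : Field.absoluteGaloisGroup ℚ} {N : ℕ} [NeZero N]
    {f : CuspForm (Gamma0 N) 2}
    (hκ : κ.IsCyclotomic) (hγ : κ.IsTopGenerator γ) (hcv : IsCyclotomicVariable p γ)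
    (hf : IsNewformOf V f) (D : W.SelmerDualData κ γ) (ϖ : ℚ)
    (hϖ : if Even (p / 2) then (ϖ : ℝ) * V.realPeriodRat = plusPeriod f
      else (ϖ : ℝ) * V.imaginaryPeriodRat = minusPeriod f) :
    D.IsTorsion ∧ D.mu = 0 := by
  haveI : Module.Finite (IwasawaAlgebra p) D.X :=
    SelmerDualData.module_finite_of_isCyclotomic (W := W) (κ := κ) hκ D hγ
  have hord : IsOrdinaryAt V p := isOrdinaryAt_of_goodOrd_or_mult_of_model_twist W V (pStar_ne_zero p)
    ⟨C, hC⟩ (padicValRat_j_nonneg_of_typeGOrd W p hX.typeGOrd) (Or.inl hV)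
  exact hX.isTorsion_and_mu_zero_of_wuthrichHalf_of_coeff hWu hp2 V ⟨C, hC⟩ hV hκ hγ hcv hf D ϖ hϖ
    (hcert V C hC hord f hf ϖ hϖ)

end Summit.BirchSwinnertonDyer.Rank1Residual.Additive

end
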